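import Literature.IUT.HodgeTheaters.GoodLocalFrobenioidOfGaloisSplitFromFConj
import Literature.IUT.HodgeTheaters.GoodLocalFrobenioidOfGalois
import Literature.AlgebraicGeometry.Frobenioids.QuasiTemperoidCosetGaloisDescent
import Literature.AlgebraicGeometry.Frobenioids.PadicFrobenioidPairIsoImage
import Literature.AlgebraicGeometry.Frobenioids.PadicKummerRelCosetGaloisConj
import Literature.NumberTheory.GaloisRepresentations.NaturalIrrationalities
import Mathlib.FieldTheory.Galois.Profinite
import HarnessLib

/-!
# [IUTchI] Ex. 3.3 (i) / [FrdII] Ex. 1.3 (iii): the Galois base `Π_v/U ↦ k̄^{aug U}` of the datum `ofComplete p k`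
# IS a genuine §2 base `Π_v/U ↦ ℚ̄_p^{φ₁ U}` (natural isomorphism of base functors; junction J-C53-BASE-ISO (J1))

S. Mochizuki, *Inter-universal Teichmüller theory I*, kurims manuscript (May 2020), Example 3.3 (i) p. 78
(«`D⊢_v := 𝓑(K_v)⁰` … `Spec(L) ↦ L`») ([IUTchI] Ex 3.3 (i) p.78) [claim: Mochizuki2012, status: disputed] (D-0012 claim key;
nothing of the series is asserted; no side is taken on [IUTchIII] Cor. 3.12).  S. Mochizuki, *The geometry of Frobenioids II*,
Kyushu J. Math. **62** (2008) 401–460, Example 1.3 (iii) pp. 11–12: «when `F = ℚ_p` … we obtain a functor `D → D₀ = B^temp(G_{ℚ_p})⁰`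
[cf. Example 1.1, (ii)] which satisfies the hypotheses of Theorem 1.2, (i)» [cite: MochizukiFrdII2008, Ex 1.3 (iii) pp.11-12];
§2 p. 17: «`Π → Q`, `G_{ℚ_p} ↠ Q` … is an isomorphism» [cite: MochizukiFrdII2008, Def 2.2 p.17].  J. Neukirch, *Algebraic Number
Theory*, Ch. II Thm. (4.8) (uniqueness of the extension of a complete valuation) [cite: NeukirchANT1999, Ch. II Thm. (4.8)].

PROOF-ONLY file (cell abc-iut; seat abc-iut-L1-t7 gen 10; junction J-C53-BASE-ISO, piece (J1) of abc-iut-L1-lead R191).  TWO base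
functors `𝓑(Π_v)⁰ = CosetCat Π_v ⥤ D₀ = PadicFld p` of one place are in the tree:
* L5's REAL carrier base `GoodLocalFrobenioid.galoisBaseV (GaloisValDatum.ofComplete p k) aug ho = CosetCat.push aug ho ⋙ fieldFunctor`,
  `Π_v/U ↦ k̄^{aug(U)}` (`k̄ = AlgebraicClosure k` with its SPECTRAL norm, `aug : Π_v → Gal(k̄/k)` open), and
* L1's GENUINE §2 base `CosetCat.push φ₁ _ ⋙ CosetCat.toConnected (isTempered_galFbar ℚ_[p]) ⋙ galoisPadicFields p`,
  `Π_v/U ↦ ℚ̄_p^{Stab}` through an open homomorphism `φ₁ : Π_v → G_{ℚ_p}` (the base of abc-iut-L1-t7's `PadicFrd.Datum.hker_genuine`).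
This file PROVES that they are ISOMORPHIC for `φ₁ := (σ ↦ e σ e⁻¹) ∘ aug` along ANY `ℚ_p`-isomorphism `e : k̄ ≅ ℚ̄_p`
(abc-iut-L5-t16's valued dictionary `GaloisValDatum.vle_map_algEquiv_padicAlgCl_iff`: every such `e` is an isomorphism of VALUED fields):
* §1 `GaloisValDatum.autCongr_restrictScalars_apply / continuous_… / range_… / isOpenMap_… / isOpenHom_…_comp` — the embedding
  `ψ_e : Gal(k̄/k) ↪ G_{ℚ_p}`, `σ ↦ e σ e⁻¹`: continuous (Krull), injective, with range the OPEN subgroup `Gal(ℚ̄_p/e(k))`, an open map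
  (continuous injection of a compact group into a Hausdorff one with open range); hence `ψ_e ∘ aug` is an open homomorphism;
* §2 `GaloisValDatum.nonempty_galoisBaseV_iso_genuine` — THE NATURAL ISOMORPHISM: at `Π_v/U` the valuative field isomorphism
  `k̄^{aug U} ⥲ ℚ̄_p^{Stab(x_U)} = ℚ̄_p^{g_U φ₁(U) g_U⁻¹}`, `x ↦ g_U · e(x)` (`g_U` a representative of the chosen base point `x_U` of
  `G_{ℚ_p}/φ₁(U)`), natural in `U` because `e(aug(π)·x) = φ₁(π)·e(x)`;
* §3 `GaloisValDatum.exists_isOpenHom_galoisBaseV_iso_genuine` — the ∃-package «there is an open homomorphism `φ₁ : Π_v → G_{ℚ_p}` with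
  `galoisBaseV (ofComplete p k) aug ho ≅ push φ₁ ⋙ toConnected ⋙ galoisPadicFields p`» (the (J1) socket; (J2) = functoriality of
  `Datum.perf` in base isomorphisms, abc-iut-L1-t4; (J3) = abc-iut-L1-t7 `CatIsomorphism.kernelTrivial_of_equivalence_over`, landed).
SCOPE (honest): only the datum `ofComplete p k` (hence `ofPlace`, `InitialThetaData.goodLocalFrobenioidOfEmb`); a general
`d : GaloisValDatum p` has an ARBITRARY Galois `Ω/k` and is not isomorphic to a genuine base in general.  No definition, instance,
notation or `Prop` fact; classical Galois/valuation theory over Mathlib and the tree; typed ≠ proved elsewhere.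
-/

noncomputable section

-- `GaloisValDatum.ofComplete` / `GoodLocalFrobenioid.galoisBaseV` unfold only at default transparency (as in the L5 kit files).
set_option backward.isDefEq.respectTransparency false

namespace Literature.IUT.HodgeTheaters

open CategoryTheory Topology Literature.AnabelianGeometry.SemiGraphs Literature.AlgebraicGeometry.Frobenioids
open Literature.AlgebraicGeometry.Frobenioids.QuasiTemperoid Literature.AlgebraicGeometry.Frobenioids.PadicFrd

namespace GaloisValDatum

/-! ### §1 The embedding `ψ_e : Gal(k̄/k) ↪ G_{ℚ_p}`, `σ ↦ e σ e⁻¹`, attached to `e : k̄ ≅ ℚ̄_p` -/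

section Embedding

variable (p : ℕ) [Fact p.Prime] (k : Type) [NontriviallyNormedField k] [CompleteSpace k] [IsUltrametricDist k]
  [NormedAlgebra ℚ_[p] k] [FiniteDimensional ℚ_[p] k] (e : AlgebraicClosure k ≃ₐ[ℚ_[p]] Fbar ℚ_[p])

omit [CompleteSpace k] [IsUltrametricDist k] [FiniteDimensional ℚ_[p] k] in
/-- Values of `ψ_e := (σ ↦ e σ e⁻¹)`: `ψ_e(σ)(e x) = e(σ x)` — `ψ_e(σ)` is `σ` read through `e`. [cite: MochizukiFrdII2008, Def 2.2 p.17] -/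
theorem autCongr_restrictScalars_apply (σ : AlgebraicClosure k ≃ₐ[k] AlgebraicClosure k) (x : AlgebraicClosure k) :
    e.autCongr (σ.restrictScalars ℚ_[p]) (e x) = e (σ x) := by
  rw [AlgEquiv.autCongr_apply, AlgEquiv.trans_apply, AlgEquiv.trans_apply, AlgEquiv.symm_apply_apply,
    AlgEquiv.restrictScalars_apply]

omit [CompleteSpace k] [IsUltrametricDist k] [FiniteDimensional ℚ_[p] k] in
/-- … equivalently `ψ_e(σ)(y) = e(σ(e⁻¹ y))`. [cite: MochizukiFrdII2008, Def 2.2 p.17] -/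
theorem autCongr_restrictScalars_apply' (σ : AlgebraicClosure k ≃ₐ[k] AlgebraicClosure k) (y : Fbar ℚ_[p]) :
    e.autCongr (σ.restrictScalars ℚ_[p]) y = e (σ (e.symm y)) := by
  conv_lhs => rw [← e.apply_symm_apply y]
  exact autCongr_restrictScalars_apply p k e σ (e.symm y)

omit [CompleteSpace k] [IsUltrametricDist k] [FiniteDimensional ℚ_[p] k] in
/-- `ψ_e` is injective. [cite: MochizukiFrdII2008, Def 2.2 p.17] -/
theorem autCongr_restrictScalars_injective :
    Function.Injective fun σ : AlgebraicClosure k ≃ₐ[k] AlgebraicClosure k => e.autCongr (σ.restrictScalars ℚ_[p]) :=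
  fun _ _ h => AlgEquiv.restrictScalars_injective ℚ_[p] (e.autCongr.injective h)

omit [CompleteSpace k] [IsUltrametricDist k] [FiniteDimensional ℚ_[p] k] in
/-- `ψ_e` is continuous for the Krull topologies (conjugation `GaloisConj.continuous_autCongr` after restriction of scalars,
the tree's `continuous_restrictScalarsHom`). [cite: MochizukiFrdII2008, Def 2.2 p.17] -/
theorem continuous_autCongr_restrictScalars :
    Continuous fun σ : AlgebraicClosure k ≃ₐ[k] AlgebraicClosure k => e.autCongr (σ.restrictScalars ℚ_[p]) :=
  (GaloisConj.continuous_autCongr e).comp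
    (Literature.NumberTheory.GaloisRepresentations.continuous_restrictScalarsHom
      (k := ℚ_[p]) (K := k) (Ω := AlgebraicClosure k))

omit [CompleteSpace k] [IsUltrametricDist k] [FiniteDimensional ℚ_[p] k] in
/-- **The range of `ψ_e` is `Gal(ℚ̄_p/e(k))`**, the fixing group of the finite extension `e(k) ⊆ ℚ̄_p` of `ℚ_p` (`⊆`: `e σ e⁻¹`
fixes `e(k)`; `⊇`: a `τ` fixing `e(k)` is `e σ e⁻¹` for the `k`-LINEAR `σ := e⁻¹ τ e`). [cite: MochizukiFrdII2008, Def 2.2 p.17] -/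
theorem range_autCongr_restrictScalars :
    Set.range (fun σ : AlgebraicClosure k ≃ₐ[k] AlgebraicClosure k => e.autCongr (σ.restrictScalars ℚ_[p])) =
      ((e.toAlgHom.comp (IsScalarTower.toAlgHom ℚ_[p] k (AlgebraicClosure k))).fieldRange.fixingSubgroup :
        Set (GalFbar ℚ_[p])) := by
  ext τ
  rw [SetLike.mem_coe, IntermediateField.mem_fixingSubgroup_iff]
  constructor
  · rintro ⟨σ, rfl⟩ y hy
    obtain ⟨c, rfl⟩ := AlgHom.mem_fieldRange.mp hy
    change e.autCongr (σ.restrictScalars ℚ_[p]) (e (algebraMap k (AlgebraicClosure k) c)) = e (algebraMap k _ c)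
    rw [autCongr_restrictScalars_apply, AlgEquiv.commutes]
  · intro hτ
    -- `σ := e⁻¹ τ e` is `k`-linear
    have hfix : ∀ c : k, e.symm (τ (e (algebraMap k (AlgebraicClosure k) c))) = algebraMap k (AlgebraicClosure k) c := by
      intro c
      have h1 := hτ _ (AlgHom.mem_fieldRange.mpr ⟨c, rfl⟩)
      change τ (e (algebraMap k (AlgebraicClosure k) c)) = e (algebraMap k (AlgebraicClosure k) c) at h1
      rw [h1, AlgEquiv.symm_apply_apply]
    let σ : AlgebraicClosure k ≃ₐ[k] AlgebraicClosure k :=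
      AlgEquiv.ofRingEquiv (f := (e.trans ((τ.restrictScalars ℚ_[p]).trans e.symm)).toRingEquiv) hfix
    refine ⟨σ, AlgEquiv.ext fun y => ?_⟩
    rw [autCongr_restrictScalars_apply']
    change e (e.symm (τ (e (e.symm y)))) = τ y
    rw [AlgEquiv.apply_symm_apply, AlgEquiv.apply_symm_apply]

omit [CompleteSpace k] [IsUltrametricDist k] in
/-- **`ψ_e` is an OPEN map**: a continuous injection of the compact group `Gal(k̄/k)` into the Hausdorff group `G_{ℚ_p}` is a closed
embedding, and its range `Gal(ℚ̄_p/e(k))` is OPEN (`e(k)/ℚ_p` finite; Krull). [cite: MochizukiFrdII2008, Def 2.2 p.17] -/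
theorem isOpenMap_autCongr_restrictScalars :
    IsOpenMap fun σ : AlgebraicClosure k ≃ₐ[k] AlgebraicClosure k => e.autCongr (σ.restrictScalars ℚ_[p]) := by
  haveI := charZero p k
  haveI : IsGalois k (AlgebraicClosure k) := {}
  haveI : Algebra.IsIntegral ℚ_[p] (Fbar ℚ_[p]) := Algebra.isAlgebraic_iff_isIntegral.mp inferInstance
  haveI : T2Space (GalFbar ℚ_[p]) := krullTopology_t2
  haveI : FiniteDimensional ℚ_[p] (e.toAlgHom.comp (IsScalarTower.toAlgHom ℚ_[p] k (AlgebraicClosure k))).fieldRange :=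
    (e.toAlgHom.comp (IsScalarTower.toAlgHom ℚ_[p] k (AlgebraicClosure k))).toLinearMap.finiteDimensional_range
  have hemb := (continuous_autCongr_restrictScalars p k e).isClosedEmbedding (autCongr_restrictScalars_injective p k e)
  have hopen : IsOpen (Set.range fun σ : AlgebraicClosure k ≃ₐ[k] AlgebraicClosure k => e.autCongr (σ.restrictScalars ℚ_[p])) := by
    rw [range_autCongr_restrictScalars]
    exact IntermediateField.fixingSubgroup_isOpen _
  exact (IsOpenEmbedding.mk hemb.toIsEmbedding hopen).isOpenMap

omit [CompleteSpace k] [IsUltrametricDist k] in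
/-- **`φ₁ := ψ_e ∘ aug : Π_v → G_{ℚ_p}` is an open homomorphism** ([FrdII] Ex. 1.3 (ii)) as soon as `aug : Π_v → Gal(k̄/k)` is continuous
and open. [cite: MochizukiFrdII2008, Ex 1.3 (ii) p.11] -/
theorem isOpenHom_autCongr_restrictScalars_comp {P : Type} [Group P] [TopologicalSpace P]
    (aug : P →* (AlgebraicClosure k ≃ₐ[k] AlgebraicClosure k)) (hc : Continuous aug) (ho : IsOpenMap aug) :
    IsOpenHom ((e.autCongr : (AlgebraicClosure k ≃ₐ[ℚ_[p]] AlgebraicClosure k) ≃* GalFbar ℚ_[p]).toMonoidHom.comp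
      ((AlgEquiv.restrictScalarsHom ℚ_[p]).comp aug)) :=
  ⟨(continuous_autCongr_restrictScalars p k e).comp hc, (isOpenMap_autCongr_restrictScalars p k e).comp ho⟩

end Embedding

/-! ### §2 The natural isomorphism `push aug ⋙ fieldFunctor ≅ push φ₁ ⋙ toConnected ⋙ galoisPadicFields p` -/

section BaseIso

variable (p : ℕ) [Fact p.Prime] (k : Type) [NontriviallyNormedField k] [CompleteSpace k] [IsUltrametricDist k]
  [NormedAlgebra ℚ_[p] k] [FiniteDimensional ℚ_[p] k] (e : AlgebraicClosure k ≃ₐ[ℚ_[p]] Fbar ℚ_[p])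
  {P : Type} [Group P] [TopologicalSpace P]
  (aug : P →* (AlgebraicClosure k ≃ₐ[k] AlgebraicClosure k)) (ho : IsOpenMap aug)
  (φ₁ : P →* GalFbar ℚ_[p]) (ho₁ : IsOpenMap φ₁) (hφ : ∀ (g : P) (x : AlgebraicClosure k), φ₁ g (e x) = e (aug g x))

/-- `G_{ℚ_p}` acts on `ℚ̄_p` by ISOMETRIES of the `p`-adic (spectral) norm (Mathlib `spectralNorm_eq_of_equiv`).
[cite: NeukirchANT1999, Ch. II Thm. (4.8)] -/
theorem norm_galFbar_apply (g : GalFbar ℚ_[p]) (y : Fbar ℚ_[p]) :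
    ‖(g y : PadicAlgCl p)‖ = ‖(y : PadicAlgCl p)‖ := by
  rw [← PadicAlgCl.spectralNorm_eq p, ← PadicAlgCl.spectralNorm_eq p]
  exact (spectralNorm_eq_of_equiv g y).symm

/-- The restricted valuation of a subfield `E ⊆ k̄` of the datum `ofComplete p k`, read through `e`: `a ≤ᵥ b` iff `‖e a‖ ≤ ‖e b‖` in
`ℚ̄_p` (abc-iut-L5-t16's valued dictionary `vle_map_algEquiv_padicAlgCl_iff`). [cite: NeukirchANT1999, Ch. II Thm. (4.8)] -/
theorem valOn_ofComplete_iff_norm (E : IntermediateField k (AlgebraicClosure k)) (a b : E) :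
    @ValuativeRel.vle E _ ((ofComplete p k).valOn E) a b ↔ ‖(e a : PadicAlgCl p)‖ ≤ ‖(e b : PadicAlgCl p)‖ :=
  ((ofComplete p k).valOn_iff E a b).trans
    ((vle_map_algEquiv_padicAlgCl_iff p k e (a : AlgebraicClosure k) b).symm.trans (padicAlgCl_vle_iff p (e a) (e b)))

omit [CompleteSpace k] [IsUltrametricDist k] [FiniteDimensional ℚ_[p] k] in
include hφ in
/-- **Well-definedness of `x ↦ g·e(x)`**: if `x ∈ k̄` is fixed by `aug(U)` and `g` represents the base point of `G_{ℚ_p}/φ₁(U)`, then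
`g·e(x)` lies in `ℚ̄_p^{Stab(x_U)} = ℚ̄_p^{g φ₁(U) g⁻¹}` (`(g φ₁(π) g⁻¹)(g e(x)) = g e(aug(π) x) = g e(x)`).
[cite: MochizukiFrdII2008, Ex 1.3 (iii) pp.11-12] -/
theorem apply_map_mem_fixFld (X : CosetCat P) {g : GalFbar ℚ_[p]}
    (hg : (g : ((CosetCat.push φ₁ ho₁).obj X).carrier) =
      basePt ((CosetCat.toConnected (isTempered_galFbar ℚ_[p])).obj ((CosetCat.push φ₁ ho₁).obj X)))
    {x : AlgebraicClosure k} (hx : x ∈ IntermediateField.fixedField (CosetCat.mapOpen aug ho X.sg).toSubgroup) :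
    g (e x) ∈ fixFld ℚ_[p] ((CosetCat.toConnected (isTempered_galFbar ℚ_[p])).obj ((CosetCat.push φ₁ ho₁).obj X)) := by
  rw [QuasiTemperoid.mem_fixFld_toConnected_iff p _ hg]
  intro w hw
  obtain ⟨π, hπ, rfl⟩ := (CosetCat.mem_mapOpen φ₁ ho₁).mp hw
  have hfix : aug π x = x :=
    (IntermediateField.mem_fixedField_iff _ x).mp hx (aug π) ((CosetCat.mem_mapOpen aug ho).mpr ⟨π, hπ, rfl⟩)
  rw [AlgEquiv.mul_apply, AlgEquiv.mul_apply, AlgEquiv.aut_inv, AlgEquiv.symm_apply_apply, hφ, hfix]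

omit [CompleteSpace k] [IsUltrametricDist k] [FiniteDimensional ℚ_[p] k] in
include hφ in
/-- … and conversely: if `y ∈ ℚ̄_p^{g φ₁(U) g⁻¹}`, then `e⁻¹(g⁻¹ y) ∈ k̄` is fixed by `aug(U)`. [cite: MochizukiFrdII2008, Ex 1.3 (iii) pp.11-12] -/
theorem symm_apply_mem_fixedField (X : CosetCat P) {g : GalFbar ℚ_[p]}
    (hg : (g : ((CosetCat.push φ₁ ho₁).obj X).carrier) =
      basePt ((CosetCat.toConnected (isTempered_galFbar ℚ_[p])).obj ((CosetCat.push φ₁ ho₁).obj X)))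
    {y : Fbar ℚ_[p]} (hy : y ∈ fixFld ℚ_[p] ((CosetCat.toConnected (isTempered_galFbar ℚ_[p])).obj ((CosetCat.push φ₁ ho₁).obj X))) :
    e.symm (g⁻¹ y) ∈ IntermediateField.fixedField (CosetCat.mapOpen aug ho X.sg).toSubgroup := by
  rw [IntermediateField.mem_fixedField_iff]
  intro u hu
  obtain ⟨π, hπ, rfl⟩ := (CosetCat.mem_mapOpen aug ho).mp hu
  have h1 := (QuasiTemperoid.mem_fixFld_toConnected_iff p _ hg y).mp hy (φ₁ π) ((CosetCat.mem_mapOpen φ₁ ho₁).mpr ⟨π, hπ, rfl⟩)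
  -- `h1 : (g φ₁(π) g⁻¹) y = y`, i.e. `φ₁(π) (g⁻¹ y) = g⁻¹ y`
  have h2 : φ₁ π (g⁻¹ y) = g⁻¹ y := by
    have h3 := congrArg (g⁻¹ : GalFbar ℚ_[p]) h1
    rwa [AlgEquiv.mul_apply, AlgEquiv.mul_apply, ← AlgEquiv.mul_apply g⁻¹ g, inv_mul_cancel, AlgEquiv.one_apply] at h3
  apply e.injective
  rw [← hφ, AlgEquiv.apply_symm_apply]
  exact h2

include hφ in
/-- **[IUTchI] Ex. 3.3 (i) / [FrdII] Ex. 1.3 (iii): the Galois base of `ofComplete p k` IS a genuine §2 base.**  For any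
`ℚ_p`-isomorphism `e : k̄ ≅ ℚ̄_p` and any `φ₁ : Π_v → G_{ℚ_p}` reading `aug` through `e` (`φ₁(π)·e(x) = e(aug(π)·x)`), there is a
natural isomorphism of base functors `𝓑(Π_v)⁰ ⥤ D₀`
`(Π_v/U ↦ k̄^{aug U}) ≅ (Π_v/U ↦ ℚ̄_p^{Stab(x_U)})`, `x_U` the chosen base point of `G_{ℚ_p}/φ₁(U)`: at `U` the valuative field
isomorphism `x ↦ g_U·e(x)` (`g_U` represents `x_U`; valuative by the dictionary and the Galois isometry), natural because both ways
round send `y ∈ ℚ̄_p^{Stab(x_{U′})}` to `aug(π)·e⁻¹(g_{U′}⁻¹ y)` (`π` represents the point of `Π_v/U → Π_v/U′`).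
([IUTchI] Ex 3.3 (i) p.78) [claim: Mochizuki2012, status: disputed] -/
theorem nonempty_galoisBaseV_iso_genuine :
    Nonempty (GoodLocalFrobenioid.galoisBaseV (ofComplete p k) aug ho ≅
      CosetCat.push φ₁ ho₁ ⋙ CosetCat.toConnected (isTempered_galFbar ℚ_[p]) ⋙ galoisPadicFields p) := by
  -- representatives `g X` of the chosen base points of the coset objects `G_{ℚ_p}/φ₁(U)`
  have hrep : ∀ X : CosetCat P, ∃ g : GalFbar ℚ_[p], (g : ((CosetCat.push φ₁ ho₁).obj X).carrier) =
      basePt ((CosetCat.toConnected (isTempered_galFbar ℚ_[p])).obj ((CosetCat.push φ₁ ho₁).obj X)) :=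
    fun X => QuotientGroup.mk_surjective _
  choose g hg using hrep
  -- the component ring isomorphisms `k̄^{aug U} ≃ ℚ̄_p^{Stab(x_U)}`, `x ↦ g·e(x)`
  let ε : ∀ X : CosetCat P,
      ↥((ofComplete p k).fixedFld ((CosetCat.push aug ho).obj X)) ≃+*
        ↥(fixFld ℚ_[p] ((CosetCat.toConnected (isTempered_galFbar ℚ_[p])).obj ((CosetCat.push φ₁ ho₁).obj X))) :=
    fun X =>
    { toFun := fun x => ⟨g X (e x.1), apply_map_mem_fixFld p k e aug ho φ₁ ho₁ hφ X (hg X) x.2⟩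
      invFun := fun y => ⟨e.symm ((g X)⁻¹ y.1), symm_apply_mem_fixedField p k e aug ho φ₁ ho₁ hφ X (hg X) y.2⟩
      left_inv := fun x => Subtype.ext (by
        change e.symm ((g X)⁻¹ (g X (e x.1))) = x.1
        rw [← AlgEquiv.mul_apply, inv_mul_cancel, AlgEquiv.one_apply, AlgEquiv.symm_apply_apply])
      right_inv := fun y => Subtype.ext (by
        change g X (e (e.symm ((g X)⁻¹ y.1))) = y.1
        rw [AlgEquiv.apply_symm_apply, ← AlgEquiv.mul_apply, mul_inv_cancel, AlgEquiv.one_apply])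
      map_mul' := fun x y => Subtype.ext (by
        change g X (e (x * y).1) = g X (e x.1) * g X (e y.1)
        rw [MulMemClass.coe_mul, map_mul, map_mul])
      map_add' := fun x y => Subtype.ext (by
        change g X (e (x + y).1) = g X (e x.1) + g X (e y.1)
        rw [AddMemClass.coe_add, map_add, map_add]) }
  -- they are valuative (the dictionary + the Galois isometry)
  have hval : ∀ (X : CosetCat P) (a b : ↥((ofComplete p k).fixedFld ((CosetCat.push aug ho).obj X))),
      @ValuativeRel.vle _ _
          (subfieldValuativeRel p
            (fixFld ℚ_[p] ((CosetCat.toConnected (isTempered_galFbar ℚ_[p])).obj ((CosetCat.push φ₁ ho₁).obj X))))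
          (ε X a) (ε X b) ↔
        @ValuativeRel.vle _ _ ((ofComplete p k).valOn ((ofComplete p k).fixedFld ((CosetCat.push aug ho).obj X))) a b := by
    intro X a b
    refine (subfield_vle_iff p _ _ _).trans ?_
    change ‖(g X (e a.1) : PadicAlgCl p)‖ ≤ ‖(g X (e b.1) : PadicAlgCl p)‖ ↔ _
    rw [norm_galFbar_apply, norm_galFbar_apply]
    exact (valOn_ofComplete_iff_norm p k e _ a b).symm
  have hval' : ∀ (X : CosetCat P)
      (a b : ↥(fixFld ℚ_[p] ((CosetCat.toConnected (isTempered_galFbar ℚ_[p])).obj ((CosetCat.push φ₁ ho₁).obj X)))),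
      @ValuativeRel.vle _ _ ((ofComplete p k).valOn ((ofComplete p k).fixedFld ((CosetCat.push aug ho).obj X)))
          ((ε X).symm a) ((ε X).symm b) ↔
        @ValuativeRel.vle _ _
          (subfieldValuativeRel p
            (fixFld ℚ_[p] ((CosetCat.toConnected (isTempered_galFbar ℚ_[p])).obj ((CosetCat.push φ₁ ho₁).obj X)))) a b := by
    intro X a b
    have h := hval X ((ε X).symm a) ((ε X).symm b)
    rw [RingEquiv.apply_symm_apply, RingEquiv.apply_symm_apply] at h
    exact h.symm
  -- the component isomorphisms of `D₀`
  let ι : ∀ X : CosetCat P,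
      (GoodLocalFrobenioid.galoisBaseV (ofComplete p k) aug ho).obj X ≅
        (CosetCat.push φ₁ ho₁ ⋙ CosetCat.toConnected (isTempered_galFbar ℚ_[p]) ⋙ galoisPadicFields p).obj X :=
    fun X =>
    { hom := ⟨(ε X).symm.toRingHom, hval' X⟩
      inv := ⟨(ε X).toRingHom, hval X⟩
      hom_inv_id := PadicFld.hom_ext (RingHom.ext fun x => (ε X).symm_apply_apply x)
      inv_hom_id := PadicFld.hom_ext (RingHom.ext fun y => (ε X).apply_symm_apply y) }
  refine ⟨NatIso.ofComponents ι fun {X Y} f => ?_⟩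
  -- naturality: a representative `π` of the point of `f : Π_v/U → Π_v/U′`
  obtain ⟨π, hπ⟩ := QuotientGroup.mk_surjective (CosetCat.pt f)
  have hpt : CosetCat.pt ((CosetCat.push aug ho).map f) = ((aug π : _) : ((CosetCat.push aug ho).obj Y).carrier) := by
    rw [CosetCat.pt_push_map, ← hπ, CosetCat.pushQuot_coe]
  have hpt₁ : ((φ₁ π : _) : ((CosetCat.push φ₁ ho₁).obj Y).carrier) = CosetCat.pt ((CosetCat.push φ₁ ho₁).map f) := by
    rw [CosetCat.pt_push_map, ← hπ, CosetCat.pushQuot_coe]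
  apply PadicFld.hom_ext
  refine RingHom.ext fun y => Subtype.ext ?_
  change ((ofComplete p k).fixedHom ((CosetCat.push aug ho).map f) ((ε Y).symm y)).1 =
    e.symm ((g X)⁻¹
      (fieldMap ((CosetCat.toConnected (isTempered_galFbar ℚ_[p])).map ((CosetCat.push φ₁ ho₁).map f)) y).1)
  rw [(ofComplete p k).fixedHom_apply_coe _ (aug π) hpt,
    BaseGaloisSystem.galoisPadicFields_toConnected_map_apply p ((CosetCat.push φ₁ ho₁).map f) (hg X) (hg Y) hpt₁ y]
  change aug π (e.symm ((g Y)⁻¹ y.1)) = e.symm ((g X)⁻¹ ((g X * φ₁ π * (g Y)⁻¹) y.1))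
  apply e.injective
  rw [← hφ, AlgEquiv.apply_symm_apply, AlgEquiv.apply_symm_apply, AlgEquiv.mul_apply, AlgEquiv.mul_apply,
    ← AlgEquiv.mul_apply (g X)⁻¹ (g X), inv_mul_cancel, AlgEquiv.one_apply]

end BaseIso

/-! ### §3 The junction socket (J1): an open homomorphism `φ₁ : Π_v → G_{ℚ_p}` and `galoisBaseV ≅` genuine base -/

section Junction

variable (p : ℕ) [Fact p.Prime] (k : Type) [NontriviallyNormedField k] [CompleteSpace k] [IsUltrametricDist k]
  [NormedAlgebra ℚ_[p] k] [FiniteDimensional ℚ_[p] k] {P : Type} [Group P] [TopologicalSpace P]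
  (aug : P →* (AlgebraicClosure k ≃ₐ[k] AlgebraicClosure k)) (hc : Continuous aug) (ho : IsOpenMap aug)

/-- **Along a given `e : k̄ ≅ ℚ̄_p`**: the canonical `φ₁ := ψ_e ∘ aug` (`σ ↦ e σ e⁻¹` after `aug`) is an open homomorphism and
`galoisBaseV (ofComplete p k) aug ho ≅ push φ₁ ⋙ toConnected ⋙ galoisPadicFields p`. ([IUTchI] Ex 3.3 (i) p.78) [claim: Mochizuki2012, status: disputed] -/
theorem nonempty_galoisBaseV_iso_genuine_of_algEquiv (e : AlgebraicClosure k ≃ₐ[ℚ_[p]] Fbar ℚ_[p]) :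
    Nonempty (GoodLocalFrobenioid.galoisBaseV (ofComplete p k) aug ho ≅
      CosetCat.push
          (((e.autCongr : (AlgebraicClosure k ≃ₐ[ℚ_[p]] AlgebraicClosure k) ≃* GalFbar ℚ_[p]).toMonoidHom.comp
            ((AlgEquiv.restrictScalarsHom ℚ_[p]).comp aug)))
          (isOpenHom_autCongr_restrictScalars_comp p k e aug hc ho).isOpenMap ⋙
        CosetCat.toConnected (isTempered_galFbar ℚ_[p]) ⋙ galoisPadicFields p) :=
  nonempty_galoisBaseV_iso_genuine p k e aug ho _ _ fun g x => autCongr_restrictScalars_apply p k e (aug g) x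

include hc in
/-- **J-C53-BASE-ISO (J1), ∃-form.**  For the datum `ofComplete p k` and any continuous open `aug : Π_v → Gal(k̄/k)` there is an
open homomorphism `φ₁ : Π_v → G_{ℚ_p}` ([FrdII] Ex. 1.3 (ii)) such that L5's real carrier base `galoisBaseV (ofComplete p k) aug ho`
is isomorphic to L1's genuine §2 base `push φ₁ ⋙ toConnected (isTempered_galFbar ℚ_[p]) ⋙ galoisPadicFields p` — the input
`eb : base₁ ≅ base₂` of the functoriality of `Datum.perf` in base isomorphisms (J2), after which abc-iut-L1-t7's
`PadicFrd.Datum.hker_genuine` (★ p504140) transports to the real carrier by `CatIsomorphism.kernelTrivial_of_equivalence_over`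
(★ p504709). ([IUTchI] Ex 3.3 (i) p.78) [claim: Mochizuki2012, status: disputed] -/
theorem exists_isOpenHom_galoisBaseV_iso_genuine :
    ∃ (φ₁ : P →* GalFbar ℚ_[p]) (hφ₁ : IsOpenHom φ₁),
      Nonempty (GoodLocalFrobenioid.galoisBaseV (ofComplete p k) aug ho ≅
        CosetCat.push φ₁ hφ₁.isOpenMap ⋙ CosetCat.toConnected (isTempered_galFbar ℚ_[p]) ⋙ galoisPadicFields p) := by
  obtain ⟨e⟩ := nonempty_algEquiv_padicAlgCl p k
  exact ⟨_, isOpenHom_autCongr_restrictScalars_comp p k e aug hc ho, nonempty_galoisBaseV_iso_genuine_of_algEquiv p k aug hc ho e⟩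

end Junction

end GaloisValDatum

end Literature.IUT.HodgeTheaters

end
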